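import Summits.NavierStokesRegularity.NavierStokesRegularity.Theses.PalasekTowerBreakdown
import Summits.NavierStokesRegularity.FluidComputer.PalasekTowerRescaledCopyHeredity

/-!
# NavierStokesRegularity — route `PalasekTowerBreakdown`: the line `fc-oneshot` on the crux `EpisodeInduction`, by name

Supports `stmt-NavierStokesRegularity-19178` (`PalasekTowerBreakdown.EpisodeInduction := EpisodeInductionG`;
ACTIVE LINE `fc-oneshot` v2.2, planner seat `ns-blowup-fc-route` g0, skeleton 7a76d86a2251fc20: stubs
`stub_heredityAtOne : PalasekTowerBreakdown.HeredityAtOne` (= child item -19249), `stub_capture :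
Capture`, `stub_renormalise : Renormalise`). Cell `ns-blowup`, seat `ns-blowup-fc-prover-3` (g0). LABEL:
E–C typing (pure glue over the landed register and the line's vocabulary module
`FluidComputer/PalasekTowerRescaledCopy.lean` + its analysis `…RescaledCopyHeredity.lean`). WHAT THIS IS
NOT: not NS — no stage, tower or instance is constructed; the crux, its children and the line's stubs are
OPEN and none is claimed here; every theorem has them (or the route's uniqueness item) as hypotheses or
states an equivalence.

Against the ROUTE DECLS, by name:

* `palasekTowerBreakdown_episodeInduction_of_capture_renormalise :
  HeredityAtOne → Capture → Renormalise → PalasekTowerBreakdown.EpisodeInduction` — the registered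
  skeleton's composition `EpisodeInduction_of`, kernel-checked against the landed register (what a
  `skeleton check` of the line reads once its stubs point at the tree names);
* `palasekTowerBreakdown_heredityFromTwo_iff_renormalise : Capture → (HeredityFromTwo ↔ Renormalise)`
  and `palasekTowerBreakdown_episodeInduction_iff_of_capture :
  Capture → (EpisodeInduction ↔ HeredityAtOne ∧ Renormalise)` — the line is LOSSLESS modulo its
  alphabet-closure stub: given `Capture`, the gate stub IS the child crux -19250;
* `palasekTowerBreakdown_episodeInduction_of_captureAtTwo_renormalise :
  HeredityAtOne → CaptureAt 2 → Renormalise → EpisodeInduction` — the stub `Capture` may be WEAKENED to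
  its first instance (propagation by silent-window uniqueness, no named fact);
* `palasekTowerBreakdown_episodeInduction_of_firstGateCopy_renormalise :
  FirstGateCopy → Renormalise → TaoForcedUniqueness → EpisodeInduction` and
  `palasekTowerBreakdown_breakdown_of_firstGateCopy_renormalise :
  EpisodeBase → FirstGateCopy → Renormalise → TaoForcedUniqueness → NavierStokesBreakdownR3` — with the
  route's own support item -19180 the two designed statements close the crux, and with the base also
  Clay (C), WITHOUT `Capture`.

References: T. Tao, J. Amer. Math. Soc. 29 (2016), §1.3 [cite: Tao2016AveragedNS, §1.3]; T. Tao,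
Anal. PDE 6 (2013), Cor. 11.4 [cite: Tao2011, Cor. 11.4]; S. Palasek, arXiv:2605.13827 §4
[cite: Palasek2026ElementaryModel, §4].
-/

-- `Summit.<Summit>.<Problem>` is the tree's mandated summit-side namespace (CONVENTIONS §2); for this
-- single-conjunct summit the two coincide, so the duplicate is deliberate.
set_option linter.dupNamespace false

namespace Summit.NavierStokesRegularity.NavierStokesRegularity.Theorems

open Summit.NavierStokesRegularity.NavierStokesRegularity.Theses
open Summit.NavierStokesRegularity.FluidComputer.PalasekTowerClayBridge

/-- **The line's composition, concluding the crux BY NAME**: first gate (= the child item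
`PalasekTowerBreakdown.HeredityAtOne`) + alphabet closure + the robust gate ⇒
`PalasekTowerBreakdown.EpisodeInduction`. Conditional on the three open stubs; nothing asserted.
[folklore] -/
theorem palasekTowerBreakdown_episodeInduction_of_capture_renormalise
    (h₁ : PalasekTowerBreakdown.HeredityAtOne) (hC : Capture) (hR : Renormalise) :
    PalasekTowerBreakdown.EpisodeInduction :=
  episodeInductionG_of_heredityAtOne_capture_renormalise h₁ hC hR

/-- Alphabet closure + the robust gate ⇒ the child crux `PalasekTowerBreakdown.HeredityFromTwo`
(item -19250) by name. [folklore] -/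
theorem palasekTowerBreakdown_heredityFromTwo_of_capture_renormalise (hC : Capture)
    (hR : Renormalise) : PalasekTowerBreakdown.HeredityFromTwo :=
  heredityFrom_two_of_capture_renormalise hC hR

/-- **Lossless modulo `Capture`**: given alphabet closure, the child crux `HeredityFromTwo` IS the gate
stub `Renormalise`. [folklore] -/
theorem palasekTowerBreakdown_heredityFromTwo_iff_renormalise (hC : Capture) :
    PalasekTowerBreakdown.HeredityFromTwo ↔ Renormalise :=
  (renormalise_iff_heredityFrom_two hC).symm

/-- **Lossless modulo `Capture`, parent form**: given alphabet closure,
`EpisodeInduction ↔ HeredityAtOne ∧ Renormalise`. [folklore] -/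
theorem palasekTowerBreakdown_episodeInduction_iff_of_capture (hC : Capture) :
    PalasekTowerBreakdown.EpisodeInduction ↔ PalasekTowerBreakdown.HeredityAtOne ∧ Renormalise :=
  episodeInductionG_iff_heredityAtOne_and_renormalise hC

/-- **The crux from the stub set with `Capture` weakened to its first instance `CaptureAt 2`**
(propagation `Renormalise → CaptureAt 2 → Capture` by silent-window uniqueness, Tao 2013 Cor. 11.4
unforced + Lemma 8.1, tree theorems). [cite: Tao2011, Cor. 11.4] -/
theorem palasekTowerBreakdown_episodeInduction_of_captureAtTwo_renormalise
    (h₁ : PalasekTowerBreakdown.HeredityAtOne) (h₂ : CaptureAt 2) (hR : Renormalise) :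
    PalasekTowerBreakdown.EpisodeInduction :=
  episodeInductionG_of_heredityAtOne_captureAtTwo_renormalise h₁ h₂ hR

/-- **The crux from the two designed statements, modulo the route's uniqueness item**:
`FirstGateCopy → Renormalise → PalasekTowerBreakdown.TaoForcedUniqueness → EpisodeInduction`.
[cite: Tao2011, Cor. 11.4] -/
theorem palasekTowerBreakdown_episodeInduction_of_firstGateCopy_renormalise (hF : FirstGateCopy)
    (hR : Renormalise) (hU : PalasekTowerBreakdown.TaoForcedUniqueness) :
    PalasekTowerBreakdown.EpisodeInduction :=
  episodeInductionG_of_firstGateCopy_renormalise' hF hR hU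

/-- **Clay (C) from the line WITHOUT `Capture`**: the route's base item, the first gate with copy output,
the robust gate and the route's uniqueness item give the registered leaf `NavierStokesBreakdownR3`
(through p420640's designed closer; it does not pass through the ∀-form crux). Conditional on all four;
none asserted. [cite: Palasek2026ElementaryModel, §4] -/
theorem palasekTowerBreakdown_breakdown_of_firstGateCopy_renormalise
    (hB : PalasekTowerBreakdown.EpisodeBase) (hF : FirstGateCopy) (hR : Renormalise)
    (hU : PalasekTowerBreakdown.TaoForcedUniqueness) :
    Summit.NavierStokesRegularity.NavierStokesRegularity.NavierStokesBreakdownR3 :=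
  navierStokesBreakdownR3_of_firstGateCopy_renormalise hB hF hR hU

end Summit.NavierStokesRegularity.NavierStokesRegularity.Theorems
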